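import Summits.Ventures.PackingBounds.ThreePointCert.S3T9Proof
import Summits.Ventures.PackingBounds.ThreePointCert.S3T22Proof
import Summits.Ventures.PackingBounds.ThreePointCert.S3T23Proof
import Summits.Ventures.PackingBounds.ThreePointCert.S3T24Proof
import Summits.Ventures.PackingBounds.SphericalCodes.TammesReading

/-!
# Tammes-type angles on `S³`, `N = 9, 22, 23, 24` points: readings of the kernel-checked three-point rows (table B2d)

Framing: lottery ticket; floor = certified bounds/negative ranges. Venture `PackingBounds` (cell `pub-packcert`),
spherical-codes family, table B2d = the open cells of Pfender's 2007 Table 2 on `S³` (the `N = 11` cell has its own file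
`DimFourElevenPoints.lean`, a two-sided exact statement).

For `N = 9, 22, 23, 24` the tree holds the kernel-checked Bachoc–Vallentin three-point certificates
`ThreePointCert.S3T<N>.tammesS3_<N>_card_le_<N-1>_sdp` (`n = 4`, degree 10, Bachoc–Vallentin multiplier set): every finite set
of unit vectors of `ℝ⁴` with pairwise inner products `≤ s_N` has at most `N - 1` elements.  Read in Tammes form: among any `N` unit
vectors of `ℝ⁴` (points of `S³`) two distinct ones make an angle `< arccos s_N`.

| `N` | `s_N` | `arccos s_N` | Pfender 2007 Table 2 (print, degrees) |
|---|---|---|---|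
| 9 | `327/2500` | `82.4842…°` | `83.65` |
| 22 | `233/500` | `62.2250…°` | `63.38` |
| 23 | `241/500` | `61.1839…°` | `62.30` |
| 24 | `2491/5000` | `60.1190…°` | `60.38` |

One-sided certified bounds, not optimality claims; for `N = 22, 23, 24` the Dostert–Kolpakov tables are the print comparison of
record (cell file FRESHNESS §16e), carried by the cell's table, not here.

## References
* C. Bachoc, F. Vallentin, New upper bounds for kissing numbers from semidefinite programming,
  J. Amer. Math. Soc. 21 (2008), Theorem 4.2. [`BachocVallentin2007`]
* F. Pfender, Improved Delsarte bounds for spherical codes in small dimensions, J. Combin. Theory Ser. A 114 (2007), Table 2.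
-/

noncomputable section

open Finset
open scoped RealInnerProductSpace

namespace Summit.Ventures.PackingBounds.SphericalCodes

/-- **`S³`, `N = 9`, inner products**: among any `9` or more unit vectors of `ℝ⁴`, two distinct ones have inner product
`> 327/2500`. -/
theorem sphereThree9_exists_inner_gt (C : Finset (EuclideanSpace ℝ (Fin 4)))
    (h1 : ∀ x ∈ C, ‖x‖ = 1) (hC : 8 < C.card) :
    ∃ x ∈ C, ∃ y ∈ C, x ≠ y ∧ (327 / 2500 : ℝ) < inner ℝ x y :=
  exists_inner_gt_of_codeBound ThreePointCert.S3T9.tammesS3_9_card_le_8_sdp C h1 hC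

/-- **`S³`, `N = 9`, angles**: among any `9` or more unit vectors of `ℝ⁴`, two distinct ones make an (unoriented) angle
`< arccos(327/2500)` (`= 82.4842…°`; Pfender 2007 Table 2 prints `83.65°`). -/
theorem sphereThree9_exists_angle_lt_arccos (C : Finset (EuclideanSpace ℝ (Fin 4)))
    (h1 : ∀ x ∈ C, ‖x‖ = 1) (hC : 8 < C.card) :
    ∃ x ∈ C, ∃ y ∈ C, x ≠ y ∧ InnerProductGeometry.angle x y < Real.arccos (327 / 2500) :=
  exists_angle_lt_arccos_of_codeBound ThreePointCert.S3T9.tammesS3_9_card_le_8_sdp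
    (by norm_num) C h1 hC

/-- **`θ_9(S³) < arccos(327/2500)`**: any common lower bound `θ` for the pairwise angles of `9` or more unit vectors of `ℝ⁴`
satisfies `θ < arccos(327/2500)` (`= 82.4842…°`). -/
theorem sphereThree9_minAngle_lt_arccos (C : Finset (EuclideanSpace ℝ (Fin 4)))
    (h1 : ∀ x ∈ C, ‖x‖ = 1) (hC : 8 < C.card) (θ : ℝ)
    (hθ : ∀ x ∈ C, ∀ y ∈ C, x ≠ y → θ ≤ InnerProductGeometry.angle x y) :
    θ < Real.arccos (327 / 2500) :=
  minAngle_lt_arccos_of_codeBound ThreePointCert.S3T9.tammesS3_9_card_le_8_sdp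
    (by norm_num) C h1 hC θ hθ

/-- **`S³`, `N = 22`, inner products**: among any `22` or more unit vectors of `ℝ⁴`, two distinct ones have inner product
`> 233/500`. -/
theorem sphereThree22_exists_inner_gt (C : Finset (EuclideanSpace ℝ (Fin 4)))
    (h1 : ∀ x ∈ C, ‖x‖ = 1) (hC : 21 < C.card) :
    ∃ x ∈ C, ∃ y ∈ C, x ≠ y ∧ (233 / 500 : ℝ) < inner ℝ x y :=
  exists_inner_gt_of_codeBound ThreePointCert.S3T22.tammesS3_22_card_le_21_sdp C h1 hC

/-- **`S³`, `N = 22`, angles**: among any `22` or more unit vectors of `ℝ⁴`, two distinct ones make an (unoriented) angle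
`< arccos(233/500)` (`= 62.2250…°`; Pfender 2007 Table 2 prints `63.38°`). -/
theorem sphereThree22_exists_angle_lt_arccos (C : Finset (EuclideanSpace ℝ (Fin 4)))
    (h1 : ∀ x ∈ C, ‖x‖ = 1) (hC : 21 < C.card) :
    ∃ x ∈ C, ∃ y ∈ C, x ≠ y ∧ InnerProductGeometry.angle x y < Real.arccos (233 / 500) :=
  exists_angle_lt_arccos_of_codeBound ThreePointCert.S3T22.tammesS3_22_card_le_21_sdp
    (by norm_num) C h1 hC

/-- **`θ_22(S³) < arccos(233/500)`**: any common lower bound `θ` for the pairwise angles of `22` or more unit vectors of `ℝ⁴`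
satisfies `θ < arccos(233/500)` (`= 62.2250…°`). -/
theorem sphereThree22_minAngle_lt_arccos (C : Finset (EuclideanSpace ℝ (Fin 4)))
    (h1 : ∀ x ∈ C, ‖x‖ = 1) (hC : 21 < C.card) (θ : ℝ)
    (hθ : ∀ x ∈ C, ∀ y ∈ C, x ≠ y → θ ≤ InnerProductGeometry.angle x y) :
    θ < Real.arccos (233 / 500) :=
  minAngle_lt_arccos_of_codeBound ThreePointCert.S3T22.tammesS3_22_card_le_21_sdp
    (by norm_num) C h1 hC θ hθ

/-- **`S³`, `N = 23`, inner products**: among any `23` or more unit vectors of `ℝ⁴`, two distinct ones have inner product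
`> 241/500`. -/
theorem sphereThree23_exists_inner_gt (C : Finset (EuclideanSpace ℝ (Fin 4)))
    (h1 : ∀ x ∈ C, ‖x‖ = 1) (hC : 22 < C.card) :
    ∃ x ∈ C, ∃ y ∈ C, x ≠ y ∧ (241 / 500 : ℝ) < inner ℝ x y :=
  exists_inner_gt_of_codeBound ThreePointCert.S3T23.tammesS3_23_card_le_22_sdp C h1 hC

/-- **`S³`, `N = 23`, angles**: among any `23` or more unit vectors of `ℝ⁴`, two distinct ones make an (unoriented) angle
`< arccos(241/500)` (`= 61.1839…°`; Pfender 2007 Table 2 prints `62.30°`). -/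
theorem sphereThree23_exists_angle_lt_arccos (C : Finset (EuclideanSpace ℝ (Fin 4)))
    (h1 : ∀ x ∈ C, ‖x‖ = 1) (hC : 22 < C.card) :
    ∃ x ∈ C, ∃ y ∈ C, x ≠ y ∧ InnerProductGeometry.angle x y < Real.arccos (241 / 500) :=
  exists_angle_lt_arccos_of_codeBound ThreePointCert.S3T23.tammesS3_23_card_le_22_sdp
    (by norm_num) C h1 hC

/-- **`θ_23(S³) < arccos(241/500)`**: any common lower bound `θ` for the pairwise angles of `23` or more unit vectors of `ℝ⁴`
satisfies `θ < arccos(241/500)` (`= 61.1839…°`). -/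
theorem sphereThree23_minAngle_lt_arccos (C : Finset (EuclideanSpace ℝ (Fin 4)))
    (h1 : ∀ x ∈ C, ‖x‖ = 1) (hC : 22 < C.card) (θ : ℝ)
    (hθ : ∀ x ∈ C, ∀ y ∈ C, x ≠ y → θ ≤ InnerProductGeometry.angle x y) :
    θ < Real.arccos (241 / 500) :=
  minAngle_lt_arccos_of_codeBound ThreePointCert.S3T23.tammesS3_23_card_le_22_sdp
    (by norm_num) C h1 hC θ hθ

/-- **`S³`, `N = 24`, inner products**: among any `24` or more unit vectors of `ℝ⁴`, two distinct ones have inner product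
`> 2491/5000`. -/
theorem sphereThree24_exists_inner_gt (C : Finset (EuclideanSpace ℝ (Fin 4)))
    (h1 : ∀ x ∈ C, ‖x‖ = 1) (hC : 23 < C.card) :
    ∃ x ∈ C, ∃ y ∈ C, x ≠ y ∧ (2491 / 5000 : ℝ) < inner ℝ x y :=
  exists_inner_gt_of_codeBound ThreePointCert.S3T24.tammesS3_24_card_le_23_sdp C h1 hC

/-- **`S³`, `N = 24`, angles**: among any `24` or more unit vectors of `ℝ⁴`, two distinct ones make an (unoriented) angle
`< arccos(2491/5000)` (`= 60.1190…°`; Pfender 2007 Table 2 prints `60.38°`). -/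
theorem sphereThree24_exists_angle_lt_arccos (C : Finset (EuclideanSpace ℝ (Fin 4)))
    (h1 : ∀ x ∈ C, ‖x‖ = 1) (hC : 23 < C.card) :
    ∃ x ∈ C, ∃ y ∈ C, x ≠ y ∧ InnerProductGeometry.angle x y < Real.arccos (2491 / 5000) :=
  exists_angle_lt_arccos_of_codeBound ThreePointCert.S3T24.tammesS3_24_card_le_23_sdp
    (by norm_num) C h1 hC

/-- **`θ_24(S³) < arccos(2491/5000)`**: any common lower bound `θ` for the pairwise angles of `24` or more unit vectors of `ℝ⁴`
satisfies `θ < arccos(2491/5000)` (`= 60.1190…°`). -/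
theorem sphereThree24_minAngle_lt_arccos (C : Finset (EuclideanSpace ℝ (Fin 4)))
    (h1 : ∀ x ∈ C, ‖x‖ = 1) (hC : 23 < C.card) (θ : ℝ)
    (hθ : ∀ x ∈ C, ∀ y ∈ C, x ≠ y → θ ≤ InnerProductGeometry.angle x y) :
    θ < Real.arccos (2491 / 5000) :=
  minAngle_lt_arccos_of_codeBound ThreePointCert.S3T24.tammesS3_24_card_le_23_sdp
    (by norm_num) C h1 hC θ hθ

end Summit.Ventures.PackingBounds.SphericalCodes

end
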